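import Mathlib
import HarnessLib

/-!
# Viscous CLM on the torus (the `a = 0` corner of the gCLM/OSW MODEL): the coefficient recursion of `ν z″ + ½ z² = λ z`
# has a nonzero analytic-signal solution only for `λ = −ν m²` — in particular NO nonzero mean-zero steady state

HONEST FRAMING (cell ns-blowup GROUP B «PROFILE SEARCH», zone Z3, case Z3-U of `HOME/profile/z3/SHEET.md` §14; human rulings
D-0035/D-0074): **1-D MODEL (viscous Constantin–Lax–Majda equation `ω_t = ω Hω + ν ω_xx` on `𝕋 = ℝ/2πℤ`, the `a = 0` member of
the viscous gCLM/OSW family); pure coefficient algebra kernel-checked; not Euler, not Navier–Stokes; «violates: none — MODEL».**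

OBJECT (companion of `SheetNSLineSchochetCornerTorus`, same conventions). For mean-zero `ω` on `𝕋` the analytic signal
`z := Hω − iω = Σ_{k ≥ 1} c_k e^{ikx}` turns the viscous CLM into `z_t = ½ z² + ν z_xx` (Cotlar's identity
`H(ωHω) = ½((Hω)² − ω²)` holds EXACTLY for mean-zero `ω`, the constant `½·mean((Hω)² − ω²)` vanishing by Parseval). A state on which
the flow acts as multiplication by `λ` at the given instant, `ν z″ + ½ z² = λ z`, has coefficients solving, for every `k ≥ 0`,

  `½ Σ_{i+j=k} c_i c_j − ν k² c_k = λ c_k`,   `c_0 = 0` (mean zero).                                        (R_λ)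

`SheetNSLineSchochetCornerTorus.torusCorner_coeff_identity` exhibits the solution `c_k = 12ν k r^k` of (R_{−ν}) (the periodised
Schochet corner, a DECAY direction). THIS FILE proves the converse structure by strong induction on the TRIANGULAR recursion:

* `lambda_eq_of_ne_zero` — **if (R_λ) has a solution with some `c_k ≠ 0`, then `λ = −ν m²` where `m ≥ 1` is the first nonzero
  index** (at `k = m` the convolution sum is empty of nonzero terms), and `c_k = 0` for `k < m`;
* `steady_coeff_eq_zero` — **`λ = 0`, `ν ≠ 0`: every solution of (R₀) with `c_0 = 0` is identically zero** — the coefficient-level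
  form of «the viscous CLM on `𝕋` has NO nonzero mean-zero steady state in the analytic-signal class» (pen remark SHEET §14.6 (ii),
  profile-refuter U-R4, previously argued via the equianharmonic `℘`; here three lines of algebra);
* `lambda_nonpos` — over `ℝ` with `ν > 0` every admissible `λ` is `≤ −ν < 0`: all such exact directions DECAY at least at the
  rate of the first Fourier mode — the MODEL-side reason, recorded for the census, why the `a = 0` torus solution of case Z3-U from
  sub-threshold data relaxes to `0` and not to a nontrivial steady profile (CENSUS-Z3 row Z3-U, F2 bracket; numbers not restated).
Function-level reading (Cotlar + Parseval + term-wise differentiation of an absolutely convergent analytic signal) = pen, exactly as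
in the companion file; the kernel content is the recursion. Works over any field (characteristic zero for the steady-state corollary). No definitions.
bears_on: LADDER-NS N5 / zone Z3 (case Z3-U) → N1 linear core. WHAT THIS IS NOT: not NS; no statement about the time-dependent
solution; not an exclusion of steady states outside the mean-zero analytic-signal class.
-/

namespace Summit.NavierStokesRegularity.OSWSelfSimilar
namespace SheetNSLineTorusRecursion

open Finset

variable {𝕜 : Type*} [Field 𝕜]

/-- At the first nonzero index `m` of a sequence with `c_0 = 0`, the Cauchy-product coefficient `Σ_{i+j=m} c_i c_j` vanishes
(every pair `(i, j)` with `i + j = m` has `i < m` or `j = 0`). [folklore] -/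
theorem antidiagonal_sum_eq_zero_of_lt (c : ℕ → 𝕜) (m : ℕ) (hlt : ∀ k, k < m → c k = 0) (h0 : c 0 = 0) :
    ∑ p ∈ antidiagonal m, c p.1 * c p.2 = 0 := by
  refine sum_eq_zero fun p hp => ?_
  have hsum : p.1 + p.2 = m := mem_antidiagonal.mp hp
  rcases Nat.lt_or_ge p.1 m with h | h
  · rw [hlt p.1 h, zero_mul]
  · have h2 : p.2 = 0 := by omega
    rw [h2, h0, mul_zero]

/-- **QUANTISATION OF THE EXACT DIRECTIONS.** If `c : ℕ → 𝕜` with `c 0 = 0` solves the coefficient recursion (R_λ)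
`½ Σ_{i+j=k} c_i c_j − ν k² c_k = λ c_k` for all `k` and is not identically zero, then `λ = −ν m²` for the least `m` with
`c m ≠ 0`, which is `≥ 1`; and `c k = 0` for all `k < m`. [new here — MODEL] -/
theorem lambda_eq_of_ne_zero (ν lam : 𝕜) (c : ℕ → 𝕜) (h0 : c 0 = 0)
    (h : ∀ k : ℕ, (1 / 2 : 𝕜) * (∑ p ∈ antidiagonal k, c p.1 * c p.2) - ν * (k : 𝕜) ^ 2 * c k = lam * c k)
    (hex : ∃ k, c k ≠ 0) :
    ∃ m : ℕ, 1 ≤ m ∧ c m ≠ 0 ∧ (∀ k, k < m → c k = 0) ∧ lam = -ν * (m : 𝕜) ^ 2 := by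
  classical
  refine ⟨Nat.find hex, ?_, Nat.find_spec hex, ?_, ?_⟩
  · rcases Nat.eq_zero_or_pos (Nat.find hex) with hz | hpos
    · exact absurd (hz ▸ h0 : c (Nat.find hex) = 0) (Nat.find_spec hex)
    · exact hpos
  · intro k hk
    by_contra hne
    exact absurd (Nat.find_min' hex hne) (not_le.mpr hk)
  · have hlt : ∀ k, k < Nat.find hex → c k = 0 := fun k hk => by
      by_contra hne
      exact absurd (Nat.find_min' hex hne) (not_le.mpr hk)
    have hm := h (Nat.find hex)
    rw [antidiagonal_sum_eq_zero_of_lt c _ hlt h0, mul_zero, zero_sub] at hm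
    -- `−ν m² c_m = λ c_m` with `c_m ≠ 0`
    have hcm : c (Nat.find hex) ≠ 0 := Nat.find_spec hex
    have : (lam - (-ν * ((Nat.find hex : ℕ) : 𝕜) ^ 2)) * c (Nat.find hex) = 0 := by linear_combination -hm
    rcases mul_eq_zero.mp this with h1 | h1
    · exact (sub_eq_zero.mp h1)
    · exact absurd h1 hcm

/-- **NO NONZERO MEAN-ZERO STEADY STATE (coefficient level).** For `ν ≠ 0`, every solution `c : ℕ → 𝕜` with `c 0 = 0` of the
steady recursion (R₀) `½ Σ_{i+j=k} c_i c_j = ν k² c_k` (all `k`) vanishes identically: the analytic signal `z = Σ_{k≥1} c_k e^{ikx}`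
of a mean-zero steady state of the viscous CLM on `𝕋` is `0`. [new here — MODEL] -/
theorem steady_coeff_eq_zero [CharZero 𝕜] (ν : 𝕜) (hν : ν ≠ 0) (c : ℕ → 𝕜) (h0 : c 0 = 0)
    (h : ∀ k : ℕ, (1 / 2 : 𝕜) * (∑ p ∈ antidiagonal k, c p.1 * c p.2) - ν * (k : 𝕜) ^ 2 * c k = 0) :
    ∀ k, c k = 0 := by
  by_contra hne
  obtain ⟨m, hm1, -, -, hlam⟩ := lambda_eq_of_ne_zero ν 0 c h0 (fun k => by rw [h k, zero_mul]) (not_forall.mp hne)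
  have hm : ((m : ℕ) : 𝕜) ≠ 0 := Nat.cast_ne_zero.mpr (by omega)
  have : ν * (m : 𝕜) ^ 2 = 0 := by
    rw [eq_comm, neg_mul, neg_eq_zero] at hlam
    exact hlam
  rcases mul_eq_zero.mp this with h1 | h1
  · exact hν h1
  · exact hm (pow_eq_zero_iff two_ne_zero |>.mp h1)

/-- Over `ℝ` with `ν > 0`: every `λ` admitting a nonzero solution of (R_λ) with `c_0 = 0` satisfies `λ ≤ −ν < 0` — every exact
direction of the viscous CLM on `𝕋` in the mean-zero analytic-signal class is a DECAY direction, at least as fast as the first Fourier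
mode (the periodised Schochet corner of `SheetNSLineSchochetCornerTorus` realises `λ = −ν`, `m = 1`). [new here — MODEL] -/
theorem lambda_nonpos (ν lam : ℝ) (hν : 0 < ν) (c : ℕ → ℝ) (h0 : c 0 = 0)
    (h : ∀ k : ℕ, (1 / 2 : ℝ) * (∑ p ∈ antidiagonal k, c p.1 * c p.2) - ν * (k : ℝ) ^ 2 * c k = lam * c k)
    (hex : ∃ k, c k ≠ 0) : lam ≤ -ν := by
  obtain ⟨m, hm1, -, -, hlam⟩ := lambda_eq_of_ne_zero ν lam c h0 h hex
  have hm : (1 : ℝ) ≤ (m : ℝ) := by exact_mod_cast hm1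
  have hm2 : (1 : ℝ) ≤ (m : ℝ) ^ 2 := by nlinarith
  have h3 : ν * 1 ≤ ν * (m : ℝ) ^ 2 := mul_le_mul_of_nonneg_left hm2 hν.le
  rw [hlam]
  linarith

end SheetNSLineTorusRecursion
end Summit.NavierStokesRegularity.OSWSelfSimilar
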